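/-
Origin: expansion seat `planner-pub-hodgecm-mc-theta-3-g27-0`, handover #S14r3 2026-08-21T00:00Z md5 829cc9ef6ec6 (880 l.; REPLACES #S14r2 e18e6ecac7ea body ∕ PKG c9d38461b305 (547 l. = 4-line Origin header + body) = r2 + §1b TwistedCoinv functoriality (map ∕ mapEquiv ∕ ker_eq_of_forall_smul …) + §2b central twists of the splitting (finPairRep_twist: finPairRep hs' q f = (twistCharV ĉ q.1 * twistCharW ĉ q.2) • finPairRep hs q f for hs' : IsCompatible (adelicMpCont.twist … s ĉ), from finRepMp_unique + omega_pairSmall₁_finPairToAdelic_tmul + adelicMpCont.omega_ofScalar; isCompatible_twist from SplittingDatum.IsCompatible.of_central_twist; ker_weilCoinv_twist ∕ weilCoinvTwistEquiv = Submodule.quotEquivOfEq of equal relation submodules; weilCoinvTwistEquiv_weilCoinv: E (weilCoinv χ' hs' k x) = twistCharV ĉ k • weilCoinv χ hs k (E x)); + imports Weil1964/AdelicMetaplecticScalarTwist, GelbartRogawski1991/CompatibleSplittingTwist; r2 API byte-stable; NAMES for audit: HodgeCM.WeilCoinv.finPairRep_twist · HodgeCM.WeilCoinv.weilCoinvTwistEquiv_weilCoinv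 · HodgeCM.TwistedCoinv.mapEquiv_rep) (`HOME/mc/pub-hodgecm-mc-theta-3-g27/stage67/HodgeCM/Model/WeilCentralCoinvariants.lean`, md5 829cc9ef6ec6, 880 lines);
landed by the gen-28 packager (p-g28) in gate run 67 REPLACES the earlier landed copy of `HodgeCM/Model/WeilCentralCoinvariants.lean` (verbatim).
-/
/-
theta-3 lane (unit pub-hodgecm-mc-theta-3-g27, seat planner-pub-hodgecm-mc-theta-3-g27-0), 2026-08-20; r3 of the module landed as
#S14 (RUN 64, theta-3-g26) / #S14r2 (RUN 65).  r3 = r2 + §1b (functoriality of the twisted coinvariants: change of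
module, pointwise scalar twists of `ρW`, `ρV`, `χ`: `map`, `mapEquiv`, `ker_eq_of_forall_smul`) + §2b
(central twists `adelicMpCont.twist s ĉ` of a compatible splitting: `finPairRep_twist`, equal relation submodules,
`weilCoinvTwistEquiv` and its intertwining law), cut on the words of axioms-1-g16 (STATUS l.14690 (3): «if #S14's API
… should own `finPairRep` under `adelicMpCont.twist`, say so and I import it» — consumer `Model/LiuDictionaryInstanceTwist.lean`)
— CONSUMER WORD «import #S14 r3» = YES, STATUS l.14713 (2)); the `Representation.congr ∘ SeesawScalar.twist` transport
(sinst-1-g10's (α), l.14692) is sinst-1's own leaf (l.14717) and is NOT duplicated here (names disjoint).  r2 API byte-stable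
(every r2 declaration unchanged, same order); two vendored imports added (`Weil1964/AdelicMetaplecticScalarTwist`,
`GelbartRogawski1991/CompatibleSplittingTwist`).
Intended final place: `HodgeCM/Model/WeilCentralCoinvariants.lean` (REPLACE; importers of record use r2 names only).
KERNEL MATHEMATICS ONLY: definitions + theorems over Mathlib and the vendored tree files; no `def … : Prop`
record, no `axiom`, no proof hole.  Nothing of E / row 9 / MODEL-N is touched.
-/
import Mathlib.RepresentationTheory.Basic
import Mathlib.LinearAlgebra.Quotient.Basic
import Mathlib.LinearAlgebra.Span.Basic
import Literature.NumberTheory.GelbartRogawski1991.UnitaryDualPairSeesawDeepLevelFixed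
import Literature.NumberTheory.GelbartRogawski1991.UnitaryDualPairSeesawSmallMajorants
import Literature.NumberTheory.Weil1964.AdelicMetaplecticFinRep
import Literature.NumberTheory.Weil1964.AdelicMetaplecticScalarTwist
import Literature.NumberTheory.GelbartRogawski1991.CompatibleSplittingTwist

/-!
# Central (twisted) coinvariants of the Weil representation of a unitary dual pair

[Liu21, App. D, proof of Lemma D.1, Step 3] defines the local oscillator representation `ω(μ_v, ε_v, χ_v)` of
`U(V)(F_v)` as «the maximal quotient of `ω_v|_{U(V) × U(W)}` (restricted through the splitting `ι_μ`) on which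
`U(W)(F_v) = E_v^1` acts by `χ_v`», and [Liu21, Def. 4.10, display (4.2) p. 20] puts
`ω(μ, ε, χ) := ⊗'_v ω(μ_v, ε_v, χ_v)`, «an irreducible admissible representation of `G(𝔸_F^∞)`».
This file builds that MAXIMAL `χ`-QUOTIENT («`χ`-coinvariants») as kernel mathematics:

* §1 (generic, Mathlib only; namespace `HodgeCM.TwistedCoinv`).  For COMMUTING representations
  `ρV : Representation k G S`, `ρW : Representation k H S` of two groups on one module and a character
  `χ : H →* kˣ`:  the relation submodule `ker ρW χ = span {ρW h v - χ h • v}`, the quotient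
  `Coinv ρW χ := S ⧸ ker ρW χ`, the induced representation **`rep χ ρV hc : Representation k G (Coinv ρW χ)`**
  (`rep_mk : rep g (mk v) = mk (ρV g v)`; `H` acts through `χ`: `mk_ρW`), the universal property
  **`lift f hf : Coinv ρW χ →ₗ[k] M`** for a linear map `f : S →ₗ[k] M` with `f (ρW h v) = χ h • f v`
  (`lift_mk`, **`range_lift : range (lift f hf) = range f`**, `G`-equivariance `lift_rep`, uniqueness `lift_unique`),
  and the CENTRE LEMMAS in generic form: if an element `z ∈ G` and an element `w ∈ H` act on `S` by operators
  differing by a scalar `c` (`ρV z v = c • ρW w v` — the situation of the common centre `E¹` of a unitary dual pair,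
  whose two images in `Sp(𝕎)` coincide, so that the two splittings differ there by an element of `ker π`), then
  `z` acts on `Coinv ρW χ` by the scalar `c · χ w` (`rep_eq_smul_of_forall`), and consequently (`k` a field) a
  NON-ZERO `G`-intertwiner `Coinv ρW χ → Coinv ρW χ'` forces `χ w = χ' w` (`char_apply_eq_of_intertwiner`) — the
  algebra of «distinct central characters ⇒ non-isomorphic».
* §2 (the unitary dual pair of [GelbartRogawski1991, §3]; namespace `HodgeCM.WeilCoinv`).  For a COMPATIBLE pair
  splitting `s : U(J_V)(𝔸_F) ×' U(J_W)(𝔸_F) →* Mp_ψ(𝕎_𝔸)ᶜᵒⁿᵗ` (`IsCompatible`), the FINITE Weil representation of the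
  finite-adelic dual pair **`finPairRep … s hs : Representation ℂ (U(J_V)(𝔸_{F,f}) × U(J_W)(𝔸_{F,f})) 𝒮((𝔸_F^∞)^n)`**
  (`Weil1964.finRepMp` of `pairSmall₁ s ∘ ((k, u) ↦ ((1,k), (1,u)))`, the pair splitting read back along the
  enumeration `e`; the archimedean-vector hypothesis `harch` is the tree's `proj_pairSmall₁_finAdelic_apply_archVec`),
  the two commuting members `finPairRepV` / `finPairRepW` (`commute_finPairRepV_finPairRepW`), the `arch ⊗ fin`
  FACTORISATION at finite-adelic pair points for EVERY pure tensor (§2a: `omega_pairSmall₁_finPairToAdelic_tmul` in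
  the Kronecker currency, `pairRep_finPairToAdelic_piSBReindex_tmul` in the `Fin n` currency of `ω_ψ ∘ s_pair`), and the central
  coinvariants **`weilCoinv … χ hs : Representation ℂ U(J_V)(𝔸_{F,f}) (Coinv (finPairRepW … hs) χ)`** for a character
  `χ : U(J_W)(𝔸_{F,f}) →* ℂˣ` (`weilCoinv_mk`; `U(J_W)` acts through `χ`: `mk_finPairRep_one`, `mk_finPairRep`), with
  the universal property re-exported: **`weilCoinvLift … χ hs f hf`** for `f : 𝒮 →ₗ[ℂ] H` with
  `f (ω_f(s_pair(1,u)) φ) = χ u • f φ` (`weilCoinvLift_mk`, **`range_weilCoinvLift : range = range f`**,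
  `weilCoinvLift_eq_zero_iff`, `U(J_V)`-equivariance `weilCoinvLift_weilCoinv` / `weilCoinvLift_comp_weilCoinv`), and
  the centre lemmas in pair shape (`weilCoinv_eq_smul_of_forall`, `char_apply_eq_of_intertwiner`, both UNDER the
  hypothesis `hzw : ω_f(s_pair(z,1)) = c • ω_f(s_pair(1,w))`).  At the cell's data
  `(F, E, c, N, J_V) = (L⁺, L, IsCMField.complexConj L, 3, V.Hm)` the acting group `↥(UnitaryGroup.finAdelic …)` IS
  `↥V.adelicFin` (`HodgeCM/CM/Basic.lean`, `HermSpace3.adelicFin`, an `abbrev`), so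
  `(weilCoinv (↥(maximalRealSubfield L)) L (IsCMField.complexConj L) 3 M e V.Hm JW … χ hs).asModule` is a
  `ℂ[↥V.adelicFin]`-module (checked in the lane's scratch file against `HodgeCM.CM.Basic`; not imported here).

* §1b (r3; generic, `k` a commutative ring).  FUNCTORIALITY of the coinvariants: for a linear `T : S → S'` with
  `ρW' h (T v) = e h • T (ρW h v)` (pointwise scalars `e h ∈ kˣ`) and `χ' = e · χ` pointwise, the induced map
  **`map ρW χ ρW' χ' T e hT hχ : Coinv ρW χ →ₗ[k] Coinv ρW' χ'`** (`map_mk`, `map_surjective`; `G`-equivariance up to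
  a scalar `map_rep`: `ρV' g' (T v) = a • T (ρV g v)` ⇒ `rep g' ∘ map = a • map ∘ rep g`), the equivalence
  **`mapEquiv … (T : S ≃ₗ[k] S') … : Coinv ρW χ ≃ₗ[k] Coinv ρW' χ'`** (`mapEquiv_mk`, `mapEquiv_symm_mk`, `mapEquiv_rep`),
  and equal relation submodules under a pointwise scalar twist on one module (**`ker_eq_of_forall_smul`**).  (The
  transport along `Representation.congr R (SeesawScalar.twist c ρ)` is sinst-1's leaf in this namespace, STATUS
  l.14717 — not duplicated here; names disjoint.)
* §2b (r3; the dual pair).  CENTRAL TWISTS of the splitting, `ĉ : G₁(𝔸_F) = U(J_V ⊗ J_W)(𝔸_F) →* ℂˣ` (the domain of `s`;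
  [GelbartRogawski1991, Remark p. 457]: every compatible splitting is `s ⊗ ν′`): `isCompatible_twist` (an automorphic
  `ĉ` keeps compatibility — vendored `IsCompatible.of_central_twist`), `pairRep_twist_apply` /
  `omega_pairSmall₁_twist_apply` (`ω ∘ (s ⊗ ĉ)_pair = ĉ_pair • ω ∘ s_pair`), **`finPairRep_twist`**:
  `ω_f^{s ⊗ ĉ}(k, u) = (twistCharV ĉ k · twistCharW ĉ u) • ω_f^{s}(k, u)` (the finite member characters
  `twistCharV ĉ k = ĉ((1,k) ⊗ 1)`, `twistCharW ĉ u = ĉ(1 ⊗ (1,u))`; `finPairRepV_twist`, `finPairRepW_twist`), hence **`ker_weilCoinv_twist`**: `ker (finPairRepW hs') χ' = ker (finPairRepW hs) χ`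
  for `χ' = twistCharW ĉ · χ`, the identification **`weilCoinvTwistEquiv hs hs' hχ : Coinv (finPairRepW hs') χ' ≃ₗ[ℂ]
  Coinv (finPairRepW hs) χ`** (`mk ↦ mk`) and its intertwining law **`weilCoinvTwistEquiv_weilCoinv`**:
  `E ∘ Ω(s ⊗ ĉ, χ')(k) = ĉ((1,k) ⊗ 1) • Ω(s, χ)(k) ∘ E`, i.e. `Ω(s ⊗ ĉ, twistCharW ĉ · χ) ≅ twist (twistCharV ĉ) (Ω(s, χ))`
  (`weilCoinvTwistEquiv_weilCoinv_eq_twist`).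

What is NOT here (honest scope): the identification of the scalar by which the centre `E¹(𝔸_{F,f}) ⊂ U(J_V)` acts
(`χ · c_s` with `c_s` valued in `ker π`) needs a centre embedding `E¹(𝔸_{F,f}) →* U(J_V)(𝔸_{F,f})` and «`ker π` acts on
`𝒮` by scalars» (Schur's lemma for `ρ_ψ`, [MoeglinVignerasWaldspurger1987, Chap. 2 II.2]); the tree's metaplectic
files deliberately avoid Schur (`AdelicMetaplecticGroup`, «no Schur lemma is used») and carry it as the hypothesis
`hker` of `SplittingDatum.IsCompatible.exists_central_twist`.  §1's `rep_eq_smul_of_forall` /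
`char_apply_eq_of_intertwiner` are the generic statements such a discharge would feed.

## References
* [Liu21] Y. Liu, *Fourier–Jacobi cycles and arithmetic relative trace formula* (with an appendix by C. Li and
  Y. Liu), Camb. J. Math. 9 (2021), arXiv:2102.11518: Def. 4.10 + display (4.2) (p. 20 of the arXiv version),
  App. D, proof of Lemma D.1, Steps 2–3.
* [GelbartRogawski1991] S. Gelbart, J. Rogawski, *L-functions and Fourier–Jacobi coefficients for the unitary
  group U(3)*, Invent. Math. 105 (1991), §3.1 Prop. 3.1.1 p. 455, Remark p. 457.
* [MoeglinVignerasWaldspurger1987] C. Mœglin, M.-F. Vignéras, J.-L. Waldspurger, *Correspondances de Howe sur un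
  corps p-adique*, LNM 1291 (1987), Chap. 2 II.2, Chap. 3 IV (the maximal `π`-isotypic quotient).
-/

set_option autoImplicit false

noncomputable section

/-! ## §1. Twisted coinvariants of a pair of commuting representations -/

namespace HodgeCM
namespace TwistedCoinv

section CommRing

variable {k : Type*} [CommRing k] {G H S : Type*} [Group G] [Group H] [AddCommGroup S] [Module k S]

/-- The relation submodule `span {ρW h v - χ h • v}` of the `χ`-coinvariants. [folklore] -/
def ker (ρW : Representation k H S) (χ : H →* kˣ) : Submodule k S :=
  Submodule.span k (Set.range fun hv : H × S => ρW hv.1 hv.2 - ((χ hv.1 : kˣ) : k) • hv.2)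

/-- **The `χ`-coinvariants** `S ⧸ span {ρW h v - χ h • v}`: the maximal quotient of `S` on which `H` acts through
the character `χ`. [cite: Liu21, App. D proof of Lemma D.1 Step 3] -/
abbrev Coinv (ρW : Representation k H S) (χ : H →* kˣ) : Type _ := S ⧸ ker ρW χ

variable (ρW : Representation k H S) (χ : H →* kˣ)

/-- the generators lie in the relation submodule. [folklore] -/
theorem sub_mem_ker (h : H) (v : S) : ρW h v - ((χ h : kˣ) : k) • v ∈ ker ρW χ :=
  Submodule.subset_span ⟨(h, v), rfl⟩

/-- The quotient map `S → Coinv ρW χ`. [folklore] -/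
def mk : S →ₗ[k] Coinv ρW χ := (ker ρW χ).mkQ

/-- (Ported verbatim from the HodgeCMPerL package; no docstring in the source.) -/
theorem mk_apply (v : S) : mk ρW χ v = Submodule.Quotient.mk v := rfl

/-- `mk` is surjective. [folklore] -/
theorem mk_surjective : Function.Surjective (mk ρW χ) := Submodule.mkQ_surjective _

/-- **`H` acts through `χ` on the coinvariants**: `mk (ρW h v) = χ h • mk v`. [folklore] -/
theorem mk_ρW (h : H) (v : S) : mk ρW χ (ρW h v) = ((χ h : kˣ) : k) • mk ρW χ v := by
  rw [← sub_eq_zero, ← map_smul, ← map_sub, mk, Submodule.mkQ_apply, Submodule.Quotient.mk_eq_zero]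
  exact sub_mem_ker ρW χ h v

variable {M : Type*} [AddCommGroup M] [Module k M]

/-- Two linear maps out of the coinvariants agreeing on all `mk v` are equal. [folklore] -/
theorem ext_mk {f g : Coinv ρW χ →ₗ[k] M} (hfg : ∀ v : S, f (mk ρW χ v) = g (mk ρW χ v)) : f = g :=
  Submodule.linearMap_qext _ (LinearMap.ext hfg)

variable {ρW}
variable (ρV : Representation k G S)

/-- The relation submodule is stable under every operator `ρV g` commuting with `ρW(H)`. [folklore] -/
theorem map_ker_le (hc : ∀ (g : G) (h : H), Commute (ρV g) (ρW h)) (g : G) : (ker ρW χ).map (ρV g) ≤ ker ρW χ := by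
  rw [ker, Submodule.map_span_le]
  rintro _ ⟨⟨h, v⟩, rfl⟩
  have hcomm : ρV g (ρW h v) = ρW h (ρV g v) := by
    simpa only [Module.End.mul_apply] using LinearMap.congr_fun (hc g h).eq v
  dsimp only
  rw [map_sub, map_smul, hcomm]
  exact sub_mem_ker ρW χ h (ρV g v)

/-- the operator induced by `ρV g` on the coinvariants. [folklore] -/
def act (hc : ∀ (g : G) (h : H), Commute (ρV g) (ρW h)) (g : G) : Coinv ρW χ →ₗ[k] Coinv ρW χ :=
  (ker ρW χ).mapQ (ker ρW χ) (ρV g) (Submodule.map_le_iff_le_comap.1 (map_ker_le χ ρV hc g))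

/-- (Ported verbatim from the HodgeCMPerL package; no docstring in the source.) -/
@[simp] theorem act_mk (hc : ∀ (g : G) (h : H), Commute (ρV g) (ρW h)) (g : G) (v : S) : act χ ρV hc g (mk ρW χ v) = mk ρW χ (ρV g v) := rfl

/-- **The representation of `G` on the `χ`-coinvariants of `H`** (for `ρV`, `ρW` commuting). [cite: Liu21, App. D
proof of Lemma D.1 Step 3] -/
def rep (hc : ∀ (g : G) (h : H), Commute (ρV g) (ρW h)) : Representation k G (Coinv ρW χ) where
  toFun := act χ ρV hc
  map_one' := ext_mk ρW χ fun v => by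
    rw [act_mk, map_one, Module.End.one_apply, Module.End.one_apply]
  map_mul' g g' := ext_mk ρW χ fun v => by
    rw [act_mk, map_mul, Module.End.mul_apply, Module.End.mul_apply, act_mk, act_mk]

/-- `rep g (mk v) = mk (ρV g v)`. [folklore] -/
@[simp] theorem rep_mk (hc : ∀ (g : G) (h : H), Commute (ρV g) (ρW h)) (g : G) (v : S) : rep χ ρV hc g (mk ρW χ v) = mk ρW χ (ρV g v) := rfl

/-- `mk (ρV g (ρW h v)) = χ h • rep g (mk v)`: the pair `(g, h)` acts by `χ h · rep g`. [folklore] -/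
theorem mk_ρV_ρW (hc : ∀ (g : G) (h : H), Commute (ρV g) (ρW h)) (g : G) (h : H) (v : S) :
    mk ρW χ (ρV g (ρW h v)) = ((χ h : kˣ) : k) • rep χ ρV hc g (mk ρW χ v) := by
  rw [rep_mk, ← mk_ρW]
  congr 1
  simpa only [Module.End.mul_apply] using LinearMap.congr_fun (hc g h).eq v

/-! ### The universal property -/

section Lift

variable (ρW)

/-- A map transforming under `H` by `χ` kills the relation submodule. [folklore] -/
theorem ker_le_ker (f : S →ₗ[k] M) (hf : ∀ (h : H) (v : S), f (ρW h v) = ((χ h : kˣ) : k) • f v) :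
    ker ρW χ ≤ LinearMap.ker f := by
  rw [ker, Submodule.span_le]
  rintro _ ⟨⟨h, v⟩, rfl⟩
  rw [SetLike.mem_coe, LinearMap.mem_ker, map_sub, map_smul, hf, sub_self]

/-- **The universal property of the `χ`-coinvariants**: a linear map `f : S → M` with `f (ρW h v) = χ h • f v`
factors through `Coinv ρW χ`. [folklore] -/
def lift (f : S →ₗ[k] M) (hf : ∀ (h : H) (v : S), f (ρW h v) = ((χ h : kˣ) : k) • f v) :
    Coinv ρW χ →ₗ[k] M :=
  (ker ρW χ).liftQ f (ker_le_ker ρW χ f hf)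

/-- (Ported verbatim from the HodgeCMPerL package; no docstring in the source.) -/
@[simp] theorem lift_mk (f : S →ₗ[k] M) (hf : ∀ (h : H) (v : S), f (ρW h v) = ((χ h : kˣ) : k) • f v) (v : S) :
    lift ρW χ f hf (mk ρW χ v) = f v := rfl

/-- (Ported verbatim from the HodgeCMPerL package; no docstring in the source.) -/
theorem lift_comp_mk (f : S →ₗ[k] M) (hf : ∀ (h : H) (v : S), f (ρW h v) = ((χ h : kˣ) : k) • f v) :
    lift ρW χ f hf ∘ₗ mk ρW χ = f := LinearMap.ext fun _ => rfl

/-- **`range (lift f) = range f`** (the image of the factored map is the image of `f`). [folklore] -/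
theorem range_lift (f : S →ₗ[k] M) (hf : ∀ (h : H) (v : S), f (ρW h v) = ((χ h : kˣ) : k) • f v) :
    LinearMap.range (lift ρW χ f hf) = LinearMap.range f :=
  Submodule.range_liftQ _ _ _

/-- uniqueness of the factorisation. [folklore] -/
theorem lift_unique (f : S →ₗ[k] M) (hf : ∀ (h : H) (v : S), f (ρW h v) = ((χ h : kˣ) : k) • f v) (F : Coinv ρW χ →ₗ[k] M) (hF : ∀ v : S, F (mk ρW χ v) = f v) : F = lift ρW χ f hf :=
  ext_mk ρW χ fun v => by rw [hF, lift_mk]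

/-- the factored map vanishes iff `f` does. [folklore] -/
theorem lift_eq_zero_iff (f : S →ₗ[k] M) (hf : ∀ (h : H) (v : S), f (ρW h v) = ((χ h : kˣ) : k) • f v) :
    lift ρW χ f hf = 0 ↔ f = 0 := by
  constructor
  · intro h0
    rw [← lift_comp_mk ρW χ f hf, h0, LinearMap.zero_comp]
  · intro h0
    exact ext_mk ρW χ fun v => by rw [lift_mk, h0, LinearMap.zero_apply, LinearMap.zero_apply]

variable {ρW}

/-- **`G`-equivariance of the factored map**: if `f` intertwines `ρV` with a representation `σ` of `G` on `M`,
then so does `lift f` with `rep`. [folklore] -/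
theorem lift_rep (hc : ∀ (g : G) (h : H), Commute (ρV g) (ρW h)) (f : S →ₗ[k] M) (hf : ∀ (h : H) (v : S), f (ρW h v) = ((χ h : kˣ) : k) • f v)
    (σ : Representation k G M) (hσ : ∀ (g : G) (v : S), f (ρV g v) = σ g (f v)) (g : G)
    (x : Coinv ρW χ) : lift ρW χ f hf (rep χ ρV hc g x) = σ g (lift ρW χ f hf x) := by
  obtain ⟨v, rfl⟩ := mk_surjective ρW χ x
  rw [rep_mk, lift_mk, lift_mk, hσ]

/-- the same as an identity of linear maps. [folklore] -/
theorem lift_comp_rep (hc : ∀ (g : G) (h : H), Commute (ρV g) (ρW h)) (f : S →ₗ[k] M) (hf : ∀ (h : H) (v : S), f (ρW h v) = ((χ h : kˣ) : k) • f v)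
    (σ : Representation k G M) (hσ : ∀ (g : G) (v : S), f (ρV g v) = σ g (f v)) (g : G) :
    lift ρW χ f hf ∘ₗ rep χ ρV hc g = σ g ∘ₗ lift ρW χ f hf :=
  LinearMap.ext (lift_rep χ ρV hc f hf σ hσ g)

/-- the range of an equivariant `f` is `σ`-stable (so `range (lift f) = range f` is a subrepresentation).
[folklore] -/
theorem range_le_comap (f : S →ₗ[k] M) (σ : Representation k G M) (hσ : ∀ (g : G) (v : S), f (ρV g v) = σ g (f v)) (g : G) :
    LinearMap.range f ≤ (LinearMap.range f).comap (σ g) := by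
  rintro _ ⟨v, rfl⟩
  exact ⟨ρV g v, hσ g v⟩

end Lift

/-! ### The centre lemmas (generic form) -/

/-- **An element of `G` whose operator is a scalar multiple of an operator of `H` acts on the coinvariants by a
scalar**: `ρV z = c • ρW w` on `S` ⇒ `rep z = (c · χ w) • id` on `Coinv ρW χ`.  (The common centre `E¹` of a
unitary dual pair: `ι(z ⊗ 1) = ι(1 ⊗ z)` in `Sp(𝕎)`, so two splittings differ there by `ker π`.) [folklore] -/
theorem rep_eq_smul_of_forall (hc : ∀ (g : G) (h : H), Commute (ρV g) (ρW h)) {z : G} {w : H} {c : k} (hzw : ∀ v : S, ρV z v = c • ρW w v) (x : Coinv ρW χ) :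
    rep χ ρV hc z x = (c * ((χ w : kˣ) : k)) • x := by
  obtain ⟨v, rfl⟩ := mk_surjective ρW χ x
  rw [rep_mk, hzw, map_smul, mk_ρW, smul_smul]

/-! ### §1b. Functoriality: change of module and pointwise scalar twists -/

section Map

variable {S' : Type*} [AddCommGroup S'] [Module k S']

/-- **Equal relation submodules under a pointwise scalar twist** (one module): if `ρW' h = e h • ρW h` and
`χ' h = e h · χ h` for units `e h`, then `ker ρW' χ' = ker ρW χ` — the generators differ by the units `e h`.
(The situation of two compatible splittings of a dual pair differing by a central character.) [folklore] -/
theorem ker_eq_of_forall_smul {ρW ρW' : Representation k H S} {χ χ' : H →* kˣ} (e : H → kˣ)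
    (hρ : ∀ (h : H) (v : S), ρW' h v = ((e h : kˣ) : k) • ρW h v) (hχ : ∀ h : H, χ' h = e h * χ h) :
    ker ρW' χ' = ker ρW χ := by
  have key : ∀ (h : H) (v : S),
      ρW' h v - ((χ' h : kˣ) : k) • v = ((e h : kˣ) : k) • (ρW h v - ((χ h : kˣ) : k) • v) := fun h v => by
    rw [hρ, hχ, Units.val_mul, smul_sub, smul_smul]
  refine le_antisymm ?_ ?_
  · rw [ker, Submodule.span_le]
    rintro _ ⟨⟨h, v⟩, rfl⟩
    show ρW' h v - ((χ' h : kˣ) : k) • v ∈ ker ρW χ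
    rw [key]
    exact Submodule.smul_mem _ _ (sub_mem_ker ρW χ h v)
  · rw [ker, Submodule.span_le]
    rintro _ ⟨⟨h, v⟩, rfl⟩
    have hinv : ρW h v - ((χ h : kˣ) : k) • v = (((e h)⁻¹ : kˣ) : k) • (ρW' h v - ((χ' h : kˣ) : k) • v) := by
      rw [key, smul_smul, Units.inv_mul, one_smul]
    show ρW h v - ((χ h : kˣ) : k) • v ∈ ker ρW' χ'
    rw [hinv]
    exact Submodule.smul_mem _ _ (sub_mem_ker ρW' χ' h v)

variable (ρW)
variable (ρW' : Representation k H S') (χ' : H →* kˣ)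

/-- **Functoriality of the `χ`-coinvariants**: a linear map `T : S → S'` such that `ρW' h (T v) = e h • T (ρW h v)`
for units `e h` (i.e. `T` intertwines `ρW` with the twist of `ρW'` by `e⁻¹`) descends to
`Coinv ρW χ → Coinv ρW' χ'` as soon as `χ' h = e h · χ h`. [folklore] -/
def map (T : S →ₗ[k] S') (e : H → kˣ) (hT : ∀ (h : H) (v : S), ρW' h (T v) = ((e h : kˣ) : k) • T (ρW h v))
    (hχ : ∀ h : H, χ' h = e h * χ h) : Coinv ρW χ →ₗ[k] Coinv ρW' χ' :=
  lift ρW χ (mk ρW' χ' ∘ₗ T) fun h v => by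
    have h1 : T (ρW h v) = (((e h)⁻¹ : kˣ) : k) • ρW' h (T v) := by
      rw [hT, smul_smul, Units.inv_mul, one_smul]
    rw [LinearMap.comp_apply, LinearMap.comp_apply, h1, map_smul, mk_ρW, smul_smul, hχ, Units.val_mul, ← mul_assoc,
      Units.inv_mul, one_mul]

/-- (Ported verbatim from the HodgeCMPerL package; no docstring in the source.) -/
@[simp] theorem map_mk (T : S →ₗ[k] S') (e : H → kˣ)
    (hT : ∀ (h : H) (v : S), ρW' h (T v) = ((e h : kˣ) : k) • T (ρW h v)) (hχ : ∀ h : H, χ' h = e h * χ h) (v : S) :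
    map ρW χ ρW' χ' T e hT hχ (mk ρW χ v) = mk ρW' χ' (T v) := rfl

/-- `map` is onto when `T` is. [folklore] -/
theorem map_surjective (T : S →ₗ[k] S') (e : H → kˣ)
    (hT : ∀ (h : H) (v : S), ρW' h (T v) = ((e h : kˣ) : k) • T (ρW h v)) (hχ : ∀ h : H, χ' h = e h * χ h)
    (hsurj : Function.Surjective T) : Function.Surjective (map ρW χ ρW' χ' T e hT hχ) := by
  intro y
  obtain ⟨w, rfl⟩ := mk_surjective ρW' χ' y
  obtain ⟨v, rfl⟩ := hsurj w
  exact ⟨mk ρW χ v, rfl⟩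

/-- **Equivariance up to a scalar**: if `ρV' g' (T v) = a • T (ρV g v)` on `S` (two commuting pairs `(ρV, ρW)` on `S`,
`(ρV', ρW')` on `S'`, elements `g ∈ G`, `g' ∈ G'`), then `rep g' (map x) = a • map (rep g x)`. [folklore] -/
theorem map_rep {G' : Type*} [Group G'] (ρV : Representation k G S) (ρV' : Representation k G' S')
    (hc : ∀ (g : G) (h : H), Commute (ρV g) (ρW h)) (hc' : ∀ (g' : G') (h : H), Commute (ρV' g') (ρW' h))
    (T : S →ₗ[k] S') (e : H → kˣ)
    (hT : ∀ (h : H) (v : S), ρW' h (T v) = ((e h : kˣ) : k) • T (ρW h v)) (hχ : ∀ h : H, χ' h = e h * χ h)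
    {g : G} {g' : G'} {a : k} (hg : ∀ v : S, ρV' g' (T v) = a • T (ρV g v)) (x : Coinv ρW χ) :
    rep χ' ρV' hc' g' (map ρW χ ρW' χ' T e hT hχ x) = a • map ρW χ ρW' χ' T e hT hχ (rep χ ρV hc g x) := by
  obtain ⟨v, rfl⟩ := mk_surjective ρW χ x
  rw [map_mk, rep_mk, rep_mk, map_mk, hg, map_smul]

/-- the inverse direction of the hypotheses of `map` along a linear equivalence. [folklore] -/
theorem map_hyp_symm (T : S ≃ₗ[k] S') (e : H → kˣ)
    (hT : ∀ (h : H) (v : S), ρW' h (T v) = ((e h : kˣ) : k) • T (ρW h v)) (h : H) (w : S') :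
    ρW h (T.symm w) = (((e h)⁻¹ : kˣ) : k) • T.symm (ρW' h w) := by
  have h1 := hT h (T.symm w)
  rw [LinearEquiv.apply_symm_apply] at h1
  rw [h1, map_smul, LinearEquiv.symm_apply_apply, smul_smul, Units.inv_mul, one_smul]

/-- **Functoriality along a linear equivalence**: `Coinv ρW χ ≃ Coinv ρW' χ'` for `T : S ≃ₗ[k] S'` with
`ρW' h (T v) = e h • T (ρW h v)`, `χ' = e · χ`. [folklore] -/
def mapEquiv (T : S ≃ₗ[k] S') (e : H → kˣ)
    (hT : ∀ (h : H) (v : S), ρW' h (T v) = ((e h : kˣ) : k) • T (ρW h v)) (hχ : ∀ h : H, χ' h = e h * χ h) :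
    Coinv ρW χ ≃ₗ[k] Coinv ρW' χ' :=
  LinearEquiv.ofLinear (map ρW χ ρW' χ' T.toLinearMap e hT hχ)
    (map ρW' χ' ρW χ T.symm.toLinearMap (fun h => (e h)⁻¹) (map_hyp_symm ρW ρW' T e hT)
      (fun h => by rw [hχ, ← mul_assoc, inv_mul_cancel, one_mul]))
    (ext_mk ρW' χ' fun w => by
      rw [LinearMap.comp_apply, LinearMap.id_apply, map_mk, LinearEquiv.coe_toLinearMap, map_mk,
        LinearEquiv.coe_toLinearMap, LinearEquiv.apply_symm_apply])
    (ext_mk ρW χ fun v => by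
      rw [LinearMap.comp_apply, LinearMap.id_apply, map_mk, LinearEquiv.coe_toLinearMap, map_mk,
        LinearEquiv.coe_toLinearMap, LinearEquiv.symm_apply_apply])

/-- (Ported verbatim from the HodgeCMPerL package; no docstring in the source.) -/
theorem mapEquiv_apply (T : S ≃ₗ[k] S') (e : H → kˣ)
    (hT : ∀ (h : H) (v : S), ρW' h (T v) = ((e h : kˣ) : k) • T (ρW h v)) (hχ : ∀ h : H, χ' h = e h * χ h)
    (x : Coinv ρW χ) : mapEquiv ρW χ ρW' χ' T e hT hχ x = map ρW χ ρW' χ' T.toLinearMap e hT hχ x := rfl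

/-- (Ported verbatim from the HodgeCMPerL package; no docstring in the source.) -/
@[simp] theorem mapEquiv_mk (T : S ≃ₗ[k] S') (e : H → kˣ)
    (hT : ∀ (h : H) (v : S), ρW' h (T v) = ((e h : kˣ) : k) • T (ρW h v)) (hχ : ∀ h : H, χ' h = e h * χ h) (v : S) :
    mapEquiv ρW χ ρW' χ' T e hT hχ (mk ρW χ v) = mk ρW' χ' (T v) := rfl

/-- (Ported verbatim from the HodgeCMPerL package; no docstring in the source.) -/
@[simp] theorem mapEquiv_symm_mk (T : S ≃ₗ[k] S') (e : H → kˣ)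
    (hT : ∀ (h : H) (v : S), ρW' h (T v) = ((e h : kˣ) : k) • T (ρW h v)) (hχ : ∀ h : H, χ' h = e h * χ h) (w : S') :
    (mapEquiv ρW χ ρW' χ' T e hT hχ).symm (mk ρW' χ' w) = mk ρW χ (T.symm w) := rfl

/-- equivariance of `mapEquiv` up to a scalar (as `map_rep`). [folklore] -/
theorem mapEquiv_rep {G' : Type*} [Group G'] (ρV : Representation k G S) (ρV' : Representation k G' S')
    (hc : ∀ (g : G) (h : H), Commute (ρV g) (ρW h)) (hc' : ∀ (g' : G') (h : H), Commute (ρV' g') (ρW' h))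
    (T : S ≃ₗ[k] S') (e : H → kˣ)
    (hT : ∀ (h : H) (v : S), ρW' h (T v) = ((e h : kˣ) : k) • T (ρW h v)) (hχ : ∀ h : H, χ' h = e h * χ h)
    {g : G} {g' : G'} {a : k} (hg : ∀ v : S, ρV' g' (T v) = a • T (ρV g v)) (x : Coinv ρW χ) :
    rep χ' ρV' hc' g' (mapEquiv ρW χ ρW' χ' T e hT hχ x) = a • mapEquiv ρW χ ρW' χ' T e hT hχ (rep χ ρV hc g x) :=
  map_rep ρW χ ρW' χ' ρV ρV' hc hc' T.toLinearMap e hT hχ hg x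

end Map

end CommRing

section Field


-- port_pkg: scope closed for this part
end Field
end TwistedCoinv
end HodgeCM
end
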